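import Summits.PneNP.PneNP.Theorems.ConvexRankGatesCliqueExtLowerBoundWidthThresholdNarrow
import Summits.PneNP.PneNP.Theorems.CliqueExtLowerBound.Negative.PermConsequences

/-!
# Calibration of the stub `stub_permSandwichable` (line `width-threshold-certificate-sparsity`,
crux `ConvexRankGates.CliqueExtLowerBound`, stmt-PneNP-10682, route PneNP/ConvexRankGates)

The registered stub `stub_permSandwichable` of the line's skeleton (r4) says: every WIDE PERM gate
(permutation-group membership on `≤ m^c` points, not of width `≤ ⌊m^{1/16}⌋₊`), fed with local child
pairs, is `(r,s)`-sandwichable on the referee pair (bare `⌈m^{1/4}⌉₊`-cliques vs complements of the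
`#E/⌊m^{1/8}⌋₊`-edge graphs) with error `1/(8 m^{c+1})`. This file records, as LANDED IMPLICATIONS
with the stub statement as an explicit hypothesis `hP` (written out verbatim; no named fact is
introduced), how strong that statement is:

* `permLowerBound_of_permSandwichable` (T1): `hP` ⇒ for every `c`, eventually in `m`, no circuit with
  `≤ m^c` gates over the PERM-only sub-basis `{∧₂, ∨₂} ∪ PERM_{m^c}` computes `CLIQUE(m, ⌈m^{1/4}⌉₊)`
  — the composition `narrowLowerBound` of `…WidthThresholdNarrow` (`core` + `inline_statement 0 c` for
  `∧₂/∨₂` + `narrowAlgebraic_statement c` for the narrow PERM gates + the referee) with `hP` plugged in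
  for the wide PERM gates.
* `onePermGate_blind_of_permSandwichable` (T2): hence no SINGLE PERM gate on `≤ m^c` points, its inputs
  wired to edges in any way (repetitions allowed), computes `CLIQUE(m, ⌈m^{1/4}⌉₊)`.
* `mspDim_lowerBound_of_permSandwichable` (T3): hence no monotone span program over `𝔽₂` of dimension
  `≤ m^c / 2` (any number of rows, rows labelled by edges) computes `CLIQUE(m, ⌈m^{1/4}⌉₊)`
  (`spanGate_isPermGate`: such a program is ONE PERM gate on `2 · dim` points).
* `abelianProgramDim_lowerBound_of_permSandwichable` (T4), `zmodSpanDim_lowerBound_of_permSandwichable`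
  (T5): the same for programs over any finite abelian group `G` (`|G| · dim ≤ m^c`), in particular for
  additive-closure (= `𝔽_p`-span, `p` prime) programs over `ZMod p` of dimension `≤ m^c / p`
  (`abelianProgram_isPermGate`).

So `stub_permSandwichable` implies a superpolynomial monotone-span-program DIMENSION lower bound for
the diagonal clique family `CLIQUE(m, ⌈m^{1/4}⌉₊)` over every prime field: the stub is at least as
hard as such bounds (in print only via lifting theorems, Pitassi–Robere 2018 / Robere–Pitassi–
Rossman–Cook 2016, and not for this family at this size). This is the calibration the lead asked
for; nothing here claims the stub.

References: S. Jukna, *Boolean Function Complexity* (2012), Thm. 9.17 [Jukna2012];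
M. Karchmer, A. Wigderson, *On span programs* (1993).
-/

set_option linter.dupNamespace false

open Literature.Computability.Complexity Filter Finset

noncomputable section

namespace Summit.PneNP.PneNP.Theorems.CliqueExtLowerBound.WidthThreshold.PermCalibration

open Summit.PneNP.PneNP.Theorems.CliqueExtLowerBound.Negative
  (spanGate_isPermGate card_zmod_two_prod abelianProgram_isPermGate card_group_prod)

open Classical in
/-- **T1. The stub implies the PERM-only lower bound at `δ = 1/4`.** If every wide PERM gate is
sandwichable on the referee pair (the statement of `stub_permSandwichable`, hypothesis `hP`), then for
every `c`, eventually in `m`, no circuit with `≤ m^c` gates over `{∧₂, ∨₂} ∪ PERM_{m^c}` computes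
`CLIQUE(m, ⌈m^{1/4}⌉₊)`. Proof: the composition of `…WidthThresholdNarrow.narrowLowerBound` — `r, s`
are maxima of the thresholds of `inline_statement 0 c` (`∧₂, ∨₂` replace themselves),
`narrowAlgebraic_statement c` (PERM gates of width `≤ ⌊m^{1/16}⌋₊`) and `hP c` (the wide ones);
intersect the eventualities with `referee_statement s` and run `core`. [cite: Jukna2012, Thm. 9.17] -/
theorem permLowerBound_of_permSandwichable :
    (∀ c : ℕ, ∃ r₀ s₀ : ℕ, 2 ≤ r₀ ∧ 2 ≤ s₀ ∧ ∀ r s : ℕ, r₀ ≤ r → s₀ ≤ s →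
      ∀ᶠ m : ℕ in atTop, ∀ φ : GateFn, IsPermGate (m ^ c) φ →
        ¬ (IsPermGate ⌊(m : ℝ) ^ (1 / 16 : ℝ)⌋₊ φ ∨ IsGRankGate ⌊(m : ℝ) ^ (1 / 16 : ℝ)⌋₊ φ) →
        ∀ (D C : Fin φ.1 → Finset (Finset ((⊤ : SimpleGraph (Fin m)).edgeSet))),
          #(univ.image fun j => (D j, C j)) ≤ m ^ (c + 3) →
          (∀ j, ∀ R ∈ D j, #R ≤ r - 1) → (∀ j, ∀ S ∈ C j, #S ≤ s - 1) →
          (∀ j x, EvalDNF (D j) x → EvalCNF (C j) x) →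
          ∃ dnf cnf : Finset (Finset ((⊤ : SimpleGraph (Fin m)).edgeSet)),
            (∀ R ∈ dnf, #R ≤ r - 1) ∧ (∀ S ∈ cnf, #S ≤ s - 1) ∧
            (∀ x, EvalDNF dnf x → EvalCNF cnf x) ∧
            (#((posGraphs m ⌈(m : ℝ) ^ (1 / 4 : ℝ)⌉₊).filter
                (fun x => φ.2 (fun j => decide (EvalDNF (D j) x)) = true ∧ ¬ EvalDNF dnf x)) : ℝ)
              ≤ (1 / (8 * (m : ℝ) ^ (c + 1))) * #(posGraphs m ⌈(m : ℝ) ^ (1 / 4 : ℝ)⌉₊) ∧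
            (#((((powersetCard (Fintype.card ((⊤ : SimpleGraph (Fin m)).edgeSet) /
              ⌊(m : ℝ) ^ (1 / 8 : ℝ)⌋₊)
            (univ : Finset ((⊤ : SimpleGraph (Fin m)).edgeSet))).image
              (fun M => fun e => decide (e ∉ M)))).filter
                (fun x => EvalCNF cnf x ∧ φ.2 (fun j => decide (EvalCNF (C j) x)) = false)) : ℝ)
              ≤ (1 / (8 * (m : ℝ) ^ (c + 1))) *
                #(((powersetCard (Fintype.card ((⊤ : SimpleGraph (Fin m)).edgeSet) /
                  ⌊(m : ℝ) ^ (1 / 8 : ℝ)⌋₊)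
            (univ : Finset ((⊤ : SimpleGraph (Fin m)).edgeSet))).image
              (fun M => fun e => decide (e ∉ M))))) →
    ∀ c : ℕ, ∀ᶠ m : ℕ in atTop, ∀ C : Circuit ((⊤ : SimpleGraph (Fin m)).edgeSet),
      C.IsOver ({GateFn.and 2, GateFn.or 2} ∪ {g | IsPermGate (m ^ c) g}) →
        C.size ≤ m ^ c → ¬ C.Computes (cliqueFn m ⌈(m : ℝ) ^ (1 / 4 : ℝ)⌉₊) := by
  intro hP c
  obtain ⟨r₁, s₁, hr₁, hs₁, hI₁⟩ := inline_statement 0 c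
  obtain ⟨r₂, s₂, hr₂, hs₂, hW⟩ := hP c
  obtain ⟨r₃, s₃, hr₃, hs₃, hN⟩ := narrowAlgebraic_statement c
  set r := max r₁ (max r₂ r₃) with hr
  set s := max s₁ (max s₂ s₃) with hs
  have hr2 : 2 ≤ r := le_trans hr₁ (le_max_left _ _)
  have hs2 : 2 ≤ s := le_trans hs₁ (le_max_left _ _)
  have E₁ := hI₁ r s (le_max_left _ _) (le_max_left _ _)
  have E₂ := hW r s ((le_max_left _ _).trans (le_max_right _ _))
    ((le_max_left _ _).trans (le_max_right _ _))
  have E₃ := hN r s ((le_max_right _ _).trans (le_max_right _ _))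
    ((le_max_right _ _).trans (le_max_right _ _))
  have E₆ := referee_statement s
  filter_upwards [E₁, E₂, E₃, E₆, eventually_ge_atTop 3] with m h₁ h₂ h₃ h₆ hm C hC hsize
  have hε0 : 0 ≤ eps m c := by unfold eps; positivity
  have htwo : eps m c + eps m c = 2 * eps m c := by ring
  refine core hr2 hs2 hm h₆.1 h₆.2
    (B := monotoneBasis ∪ {g | IsPermGate (m ^ c) g}) ?_ ?_ C hC hsize
  · rintro φ (hφ | hφ)
    · rcases hφ with rfl | rfl
      · exact GateFn.and_monotone 2
      · exact GateFn.or_monotone 2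
    · exact IsPermGate.monotone hφ
  · rintro φ (hφ | hφ)
    · rw [pow_zero] at h₁
      exact htwo ▸ sandwichable_of_replaceable (replaceable_of_mem_monotoneBasis le_rfl hε0 hφ) h₁
    · by_cases hn : IsPermGate (TT m) φ ∨ IsGRankGate (TT m) φ
      · exact (h₃ φ hn).of_le (by linarith)
      · have hS : Sandwichable r s (m ^ (c + 3)) (posFam m) (negFam m) (eps m c) φ := h₂ φ hφ hn
        exact hS.of_le (by linarith)

open Classical in
/-- **T2. The stub implies that a single wide PERM gate is blind.** Under `hP`, for every `c`,
eventually in `m`, NO single PERM gate on `≤ m^c` points — any arity `n`, any wiring `w` of its inputs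
to the edge slots (repetitions allowed) — computes `CLIQUE(m, ⌈m^{1/4}⌉₊)`: it would be a size-one
circuit over `{∧₂, ∨₂} ∪ PERM_{m^c}` (`CktSize.gate`), contradicting T1. [folklore] -/
theorem onePermGate_blind_of_permSandwichable
    (hP : ∀ c : ℕ, ∃ r₀ s₀ : ℕ, 2 ≤ r₀ ∧ 2 ≤ s₀ ∧ ∀ r s : ℕ, r₀ ≤ r → s₀ ≤ s →
      ∀ᶠ m : ℕ in atTop, ∀ φ : GateFn, IsPermGate (m ^ c) φ →
        ¬ (IsPermGate ⌊(m : ℝ) ^ (1 / 16 : ℝ)⌋₊ φ ∨ IsGRankGate ⌊(m : ℝ) ^ (1 / 16 : ℝ)⌋₊ φ) →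
        ∀ (D C : Fin φ.1 → Finset (Finset ((⊤ : SimpleGraph (Fin m)).edgeSet))),
          #(univ.image fun j => (D j, C j)) ≤ m ^ (c + 3) →
          (∀ j, ∀ R ∈ D j, #R ≤ r - 1) → (∀ j, ∀ S ∈ C j, #S ≤ s - 1) →
          (∀ j x, EvalDNF (D j) x → EvalCNF (C j) x) →
          ∃ dnf cnf : Finset (Finset ((⊤ : SimpleGraph (Fin m)).edgeSet)),
            (∀ R ∈ dnf, #R ≤ r - 1) ∧ (∀ S ∈ cnf, #S ≤ s - 1) ∧
            (∀ x, EvalDNF dnf x → EvalCNF cnf x) ∧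
            (#((posGraphs m ⌈(m : ℝ) ^ (1 / 4 : ℝ)⌉₊).filter
                (fun x => φ.2 (fun j => decide (EvalDNF (D j) x)) = true ∧ ¬ EvalDNF dnf x)) : ℝ)
              ≤ (1 / (8 * (m : ℝ) ^ (c + 1))) * #(posGraphs m ⌈(m : ℝ) ^ (1 / 4 : ℝ)⌉₊) ∧
            (#((((powersetCard (Fintype.card ((⊤ : SimpleGraph (Fin m)).edgeSet) /
              ⌊(m : ℝ) ^ (1 / 8 : ℝ)⌋₊)
            (univ : Finset ((⊤ : SimpleGraph (Fin m)).edgeSet))).image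
              (fun M => fun e => decide (e ∉ M)))).filter
                (fun x => EvalCNF cnf x ∧ φ.2 (fun j => decide (EvalCNF (C j) x)) = false)) : ℝ)
              ≤ (1 / (8 * (m : ℝ) ^ (c + 1))) *
                #(((powersetCard (Fintype.card ((⊤ : SimpleGraph (Fin m)).edgeSet) /
                  ⌊(m : ℝ) ^ (1 / 8 : ℝ)⌋₊)
            (univ : Finset ((⊤ : SimpleGraph (Fin m)).edgeSet))).image
              (fun M => fun e => decide (e ∉ M))))) :
    ∀ c : ℕ, ∀ᶠ m : ℕ in atTop, ∀ (n : ℕ) (f : (Fin n → Bool) → Bool)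
      (w : Fin n → (⊤ : SimpleGraph (Fin m)).edgeSet), IsPermGate (m ^ c) ⟨n, f⟩ →
        ¬ ∀ x : (⊤ : SimpleGraph (Fin m)).edgeSet → Bool,
          f (fun i => x (w i)) = cliqueFn m ⌈(m : ℝ) ^ (1 / 4 : ℝ)⌉₊ x := by
  classical
  intro c
  filter_upwards [permLowerBound_of_permSandwichable hP c, eventually_ge_atTop 1] with m hm h1 n f w
    hgate hcomp
  obtain ⟨C, hC, hs, he⟩ := (CktSize.gate (B := {GateFn.and 2, GateFn.or 2} ∪
    {g | IsPermGate (m ^ c) g}) ⟨n, f⟩ (Or.inr hgate) w).toCircuit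
  refine hm C hC (hs.trans (Nat.one_le_pow _ _ h1)) fun x => ?_
  rw [he x]
  exact hcomp x

open Classical in
/-- **T3. The stub implies a superpolynomial 𝔽₂ monotone-span-program DIMENSION lower bound for
`CLIQUE(m, ⌈m^{1/4}⌉₊)`.** Under `hP`, for every `c`, eventually in `m`, NO 𝔽₂ span program of
dimension `|κ| ≤ m^c / 2` — any number `n` of rows `ρ i ∈ 𝔽₂^κ`, row `i` labelled by the edge `w i`,
target `t`, accepting `x` iff `t` lies in the span (= additive closure) of the rows of the on-edges —
computes `CLIQUE(m, ⌈m^{1/4}⌉₊)`: such a program is ONE PERM gate on `2|κ| ≤ m^c` points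
(`spanGate_isPermGate`), blind by T2. [folklore] -/
theorem mspDim_lowerBound_of_permSandwichable
    (hP : ∀ c : ℕ, ∃ r₀ s₀ : ℕ, 2 ≤ r₀ ∧ 2 ≤ s₀ ∧ ∀ r s : ℕ, r₀ ≤ r → s₀ ≤ s →
      ∀ᶠ m : ℕ in atTop, ∀ φ : GateFn, IsPermGate (m ^ c) φ →
        ¬ (IsPermGate ⌊(m : ℝ) ^ (1 / 16 : ℝ)⌋₊ φ ∨ IsGRankGate ⌊(m : ℝ) ^ (1 / 16 : ℝ)⌋₊ φ) →
        ∀ (D C : Fin φ.1 → Finset (Finset ((⊤ : SimpleGraph (Fin m)).edgeSet))),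
          #(univ.image fun j => (D j, C j)) ≤ m ^ (c + 3) →
          (∀ j, ∀ R ∈ D j, #R ≤ r - 1) → (∀ j, ∀ S ∈ C j, #S ≤ s - 1) →
          (∀ j x, EvalDNF (D j) x → EvalCNF (C j) x) →
          ∃ dnf cnf : Finset (Finset ((⊤ : SimpleGraph (Fin m)).edgeSet)),
            (∀ R ∈ dnf, #R ≤ r - 1) ∧ (∀ S ∈ cnf, #S ≤ s - 1) ∧
            (∀ x, EvalDNF dnf x → EvalCNF cnf x) ∧
            (#((posGraphs m ⌈(m : ℝ) ^ (1 / 4 : ℝ)⌉₊).filter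
                (fun x => φ.2 (fun j => decide (EvalDNF (D j) x)) = true ∧ ¬ EvalDNF dnf x)) : ℝ)
              ≤ (1 / (8 * (m : ℝ) ^ (c + 1))) * #(posGraphs m ⌈(m : ℝ) ^ (1 / 4 : ℝ)⌉₊) ∧
            (#((((powersetCard (Fintype.card ((⊤ : SimpleGraph (Fin m)).edgeSet) /
              ⌊(m : ℝ) ^ (1 / 8 : ℝ)⌋₊)
            (univ : Finset ((⊤ : SimpleGraph (Fin m)).edgeSet))).image
              (fun M => fun e => decide (e ∉ M)))).filter
                (fun x => EvalCNF cnf x ∧ φ.2 (fun j => decide (EvalCNF (C j) x)) = false)) : ℝ)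
              ≤ (1 / (8 * (m : ℝ) ^ (c + 1))) *
                #(((powersetCard (Fintype.card ((⊤ : SimpleGraph (Fin m)).edgeSet) /
                  ⌊(m : ℝ) ^ (1 / 8 : ℝ)⌋₊)
            (univ : Finset ((⊤ : SimpleGraph (Fin m)).edgeSet))).image
              (fun M => fun e => decide (e ∉ M))))) :
    ∀ c : ℕ, ∀ᶠ m : ℕ in atTop, ∀ (κ : Type) [Fintype κ] (n : ℕ) (ρ : Fin n → κ → ZMod 2)
      (t : κ → ZMod 2) (w : Fin n → (⊤ : SimpleGraph (Fin m)).edgeSet),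
      2 * Fintype.card κ ≤ m ^ c →
        ¬ ∀ x : (⊤ : SimpleGraph (Fin m)).edgeSet → Bool,
          cliqueFn m ⌈(m : ℝ) ^ (1 / 4 : ℝ)⌉₊ x = true ↔
            Multiplicative.ofAdd t ∈ Subgroup.closure
              ((fun i => Multiplicative.ofAdd (ρ i)) '' {i | x (w i) = true}) := by
  classical
  intro c
  filter_upwards [onePermGate_blind_of_permSandwichable hP c] with m hm κ _ n ρ t w hcard hcomp
  -- the span program is one PERM gate of width `2|κ| ≤ m^c`, wired by `w`
  let f : (Fin n → Bool) → Bool := fun v => decide (Multiplicative.ofAdd t ∈ Subgroup.closure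
    ((fun i => Multiplicative.ofAdd (ρ i)) '' {i | v i = true}))
  have hf : ∀ v, f v = true ↔ Multiplicative.ofAdd t ∈ Subgroup.closure
      ((fun i => Multiplicative.ofAdd (ρ i)) '' {i | v i = true}) := fun v => decide_eq_true_iff
  have hgate : IsPermGate (m ^ c) ⟨n, f⟩ :=
    (spanGate_isPermGate ρ t f hf).mono (by rw [card_zmod_two_prod]; exact hcard)
  refine hm n f w hgate fun x => ?_
  rw [Bool.eq_iff_iff]
  show f (fun a => x (w a)) = true ↔ _
  rw [hf, hcomp x]

open Classical in
/-- **T4. The same for every finite ABELIAN group program.** Under `hP`, for every `c`, eventually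
in `m`, for every finite abelian group `G` and coordinate set `κ` with `|G| · |κ| ≤ m^c`, NO program
"rows `ρ i ∈ G^κ` labelled by edges `w i`, target `t`, accept `x` iff `t` lies in the subgroup
generated by the rows of the on-edges" computes `CLIQUE(m, ⌈m^{1/4}⌉₊)`: it is ONE PERM gate on
`|G| · |κ|` points (`abelianProgram_isPermGate`, translations of `G × κ`), blind by T2. [folklore] -/
theorem abelianProgramDim_lowerBound_of_permSandwichable
    (hP : ∀ c : ℕ, ∃ r₀ s₀ : ℕ, 2 ≤ r₀ ∧ 2 ≤ s₀ ∧ ∀ r s : ℕ, r₀ ≤ r → s₀ ≤ s →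
      ∀ᶠ m : ℕ in atTop, ∀ φ : GateFn, IsPermGate (m ^ c) φ →
        ¬ (IsPermGate ⌊(m : ℝ) ^ (1 / 16 : ℝ)⌋₊ φ ∨ IsGRankGate ⌊(m : ℝ) ^ (1 / 16 : ℝ)⌋₊ φ) →
        ∀ (D C : Fin φ.1 → Finset (Finset ((⊤ : SimpleGraph (Fin m)).edgeSet))),
          #(univ.image fun j => (D j, C j)) ≤ m ^ (c + 3) →
          (∀ j, ∀ R ∈ D j, #R ≤ r - 1) → (∀ j, ∀ S ∈ C j, #S ≤ s - 1) →
          (∀ j x, EvalDNF (D j) x → EvalCNF (C j) x) →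
          ∃ dnf cnf : Finset (Finset ((⊤ : SimpleGraph (Fin m)).edgeSet)),
            (∀ R ∈ dnf, #R ≤ r - 1) ∧ (∀ S ∈ cnf, #S ≤ s - 1) ∧
            (∀ x, EvalDNF dnf x → EvalCNF cnf x) ∧
            (#((posGraphs m ⌈(m : ℝ) ^ (1 / 4 : ℝ)⌉₊).filter
                (fun x => φ.2 (fun j => decide (EvalDNF (D j) x)) = true ∧ ¬ EvalDNF dnf x)) : ℝ)
              ≤ (1 / (8 * (m : ℝ) ^ (c + 1))) * #(posGraphs m ⌈(m : ℝ) ^ (1 / 4 : ℝ)⌉₊) ∧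
            (#((((powersetCard (Fintype.card ((⊤ : SimpleGraph (Fin m)).edgeSet) /
              ⌊(m : ℝ) ^ (1 / 8 : ℝ)⌋₊)
            (univ : Finset ((⊤ : SimpleGraph (Fin m)).edgeSet))).image
              (fun M => fun e => decide (e ∉ M)))).filter
                (fun x => EvalCNF cnf x ∧ φ.2 (fun j => decide (EvalCNF (C j) x)) = false)) : ℝ)
              ≤ (1 / (8 * (m : ℝ) ^ (c + 1))) *
                #(((powersetCard (Fintype.card ((⊤ : SimpleGraph (Fin m)).edgeSet) /
                  ⌊(m : ℝ) ^ (1 / 8 : ℝ)⌋₊)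
            (univ : Finset ((⊤ : SimpleGraph (Fin m)).edgeSet))).image
              (fun M => fun e => decide (e ∉ M))))) :
    ∀ c : ℕ, ∀ᶠ m : ℕ in atTop, ∀ (G : Type) [AddCommGroup G] [Fintype G] (κ : Type) [Fintype κ]
      (n : ℕ) (ρ : Fin n → κ → G) (t : κ → G) (w : Fin n → (⊤ : SimpleGraph (Fin m)).edgeSet),
      Fintype.card G * Fintype.card κ ≤ m ^ c →
        ¬ ∀ x : (⊤ : SimpleGraph (Fin m)).edgeSet → Bool,
          cliqueFn m ⌈(m : ℝ) ^ (1 / 4 : ℝ)⌉₊ x = true ↔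
            Multiplicative.ofAdd t ∈ Subgroup.closure
              ((fun i => Multiplicative.ofAdd (ρ i)) '' {i | x (w i) = true}) := by
  classical
  intro c
  filter_upwards [onePermGate_blind_of_permSandwichable hP c] with m hm G _ _ κ _ n ρ t w hcard hcomp
  -- the group program is one PERM gate of width `|G|·|κ| ≤ m^c`, wired by `w`
  let f : (Fin n → Bool) → Bool := fun v => decide (Multiplicative.ofAdd t ∈ Subgroup.closure
    ((fun i => Multiplicative.ofAdd (ρ i)) '' {i | v i = true}))
  have hf : ∀ v, f v = true ↔ Multiplicative.ofAdd t ∈ Subgroup.closure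
      ((fun i => Multiplicative.ofAdd (ρ i)) '' {i | v i = true}) := fun v => decide_eq_true_iff
  have hgate : IsPermGate (m ^ c) ⟨n, f⟩ :=
    (abelianProgram_isPermGate ρ t f hf).mono (by rw [card_group_prod]; exact hcard)
  refine hm n f w hgate fun x => ?_
  rw [Bool.eq_iff_iff]
  show f (fun a => x (w a)) = true ↔ _
  rw [hf, hcomp x]

open Classical in
/-- **T5. In particular over every `ZMod p`** (`p ≥ 1`; for `p` prime the additive closure in
`(ZMod p)^κ` is the `𝔽_p`-span, i.e. these are exactly the monotone span programs over `𝔽_p` with rows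
labelled by edges): under `hP`, for every `c`, eventually in `m`, no such program of dimension
`|κ|` with `p · |κ| ≤ m^c` computes `CLIQUE(m, ⌈m^{1/4}⌉₊)`. [folklore] -/
theorem zmodSpanDim_lowerBound_of_permSandwichable
    (hP : ∀ c : ℕ, ∃ r₀ s₀ : ℕ, 2 ≤ r₀ ∧ 2 ≤ s₀ ∧ ∀ r s : ℕ, r₀ ≤ r → s₀ ≤ s →
      ∀ᶠ m : ℕ in atTop, ∀ φ : GateFn, IsPermGate (m ^ c) φ →
        ¬ (IsPermGate ⌊(m : ℝ) ^ (1 / 16 : ℝ)⌋₊ φ ∨ IsGRankGate ⌊(m : ℝ) ^ (1 / 16 : ℝ)⌋₊ φ) →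
        ∀ (D C : Fin φ.1 → Finset (Finset ((⊤ : SimpleGraph (Fin m)).edgeSet))),
          #(univ.image fun j => (D j, C j)) ≤ m ^ (c + 3) →
          (∀ j, ∀ R ∈ D j, #R ≤ r - 1) → (∀ j, ∀ S ∈ C j, #S ≤ s - 1) →
          (∀ j x, EvalDNF (D j) x → EvalCNF (C j) x) →
          ∃ dnf cnf : Finset (Finset ((⊤ : SimpleGraph (Fin m)).edgeSet)),
            (∀ R ∈ dnf, #R ≤ r - 1) ∧ (∀ S ∈ cnf, #S ≤ s - 1) ∧
            (∀ x, EvalDNF dnf x → EvalCNF cnf x) ∧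
            (#((posGraphs m ⌈(m : ℝ) ^ (1 / 4 : ℝ)⌉₊).filter
                (fun x => φ.2 (fun j => decide (EvalDNF (D j) x)) = true ∧ ¬ EvalDNF dnf x)) : ℝ)
              ≤ (1 / (8 * (m : ℝ) ^ (c + 1))) * #(posGraphs m ⌈(m : ℝ) ^ (1 / 4 : ℝ)⌉₊) ∧
            (#((((powersetCard (Fintype.card ((⊤ : SimpleGraph (Fin m)).edgeSet) /
              ⌊(m : ℝ) ^ (1 / 8 : ℝ)⌋₊)
            (univ : Finset ((⊤ : SimpleGraph (Fin m)).edgeSet))).image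
              (fun M => fun e => decide (e ∉ M)))).filter
                (fun x => EvalCNF cnf x ∧ φ.2 (fun j => decide (EvalCNF (C j) x)) = false)) : ℝ)
              ≤ (1 / (8 * (m : ℝ) ^ (c + 1))) *
                #(((powersetCard (Fintype.card ((⊤ : SimpleGraph (Fin m)).edgeSet) /
                  ⌊(m : ℝ) ^ (1 / 8 : ℝ)⌋₊)
            (univ : Finset ((⊤ : SimpleGraph (Fin m)).edgeSet))).image
              (fun M => fun e => decide (e ∉ M))))) :
    ∀ c : ℕ, ∀ᶠ m : ℕ in atTop, ∀ (p : ℕ) [NeZero p] (κ : Type) [Fintype κ]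
      (n : ℕ) (ρ : Fin n → κ → ZMod p) (t : κ → ZMod p) (w : Fin n → (⊤ : SimpleGraph (Fin m)).edgeSet),
      p * Fintype.card κ ≤ m ^ c →
        ¬ ∀ x : (⊤ : SimpleGraph (Fin m)).edgeSet → Bool,
          cliqueFn m ⌈(m : ℝ) ^ (1 / 4 : ℝ)⌉₊ x = true ↔
            Multiplicative.ofAdd t ∈ Subgroup.closure
              ((fun i => Multiplicative.ofAdd (ρ i)) '' {i | x (w i) = true}) := by
  intro c
  filter_upwards [abelianProgramDim_lowerBound_of_permSandwichable hP c] with m hm p _ κ _ n ρ t w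
    hcard
  exact hm (ZMod p) κ n ρ t w (by rw [ZMod.card]; exact hcard)

end Summit.PneNP.PneNP.Theorems.CliqueExtLowerBound.WidthThreshold.PermCalibration

end
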